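import Literature.MathematicalPhysics.QuantumFieldTheory.QCDTransferMatrix
import Literature.MathematicalPhysics.QuantumLattice.CPeriodicBoundaryConditions
import Summits.QuantumFields.QCD.Theorems.QuarksAsStableActionStableActionBridgeFermionSliceContinuous
import Summits.QuantumFields.QCD.Theorems.QuarksAsStableActionStableActionBridgeSliceGammaConjugation
import HarnessLib

/-!
# Charge conjugation of Smit's one-particle fermionic transfer matrix
(stub `stub_fermionSliceMatrix_chargeConj` of line `twisted_trace_transfer` for crux
`QuarksAsStableAction.StableActionBridge`, item stmt-QuantumFields-9737, `--supports`; sub-goal Q2b₁ of step E3)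

Step E3 of the line realises Lüscher's transfer matrix of lattice QCD as an `L²` integral operator; to see that
its vacuum is fermion-even one uses charge conjugation = particle–hole conjugation on the slice Fock space ×
complex conjugation `U ↦ Ū` of the links (`suConj 3`).  At the Fock level `P_h Γ(M) P_h⁻¹ = det M · Γ(M⁻ᵀ)`
(a sibling stub), so at the ONE-particle level one needs: `M_F(U)⁻ᵀ` is unitarily equivalent, by a FIXED spin
rotation `1 ⊗ w`, to `M_F(Ū)`, where
`M_F(U) = (1 − N)(A⁻¹ ⊗ P⁺ + A ⊗ P⁻)(1 − Nᴴ)` (`fermionSliceMatrix`, Smit, *Introduction to Quantum Fields on a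
Lattice*, §6.5 (6.91)), `A = sliceMassHop U mq`, `N = (1 ⊗ P⁻) D (1 ⊗ P⁺)` (`sliceNilp`),
`D = ½ Σ_j (W_j − W_jᴴ) ⊗ γ₄γ_j` (`sliceDiracKinetic`), `P± = ½ (1 ± γ₄)`, `γ₄ := euclideanGamma 0`.

We prove it with `w := C γ₄`, `C = chargeConj = γ₁γ₃` (`C⁻¹ γ_μ C = −γ_μᵀ`, Lucini–Patella–Ramos–Tantalo 2016):

* spin algebra (§1): in the tree's chiral basis `γ₄ᵀ = −γ₄`, hence `P⁺ᵀ = P⁻`, `P⁻ᵀ = P⁺`; from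
  `γ_μ C = −C γ_μᵀ` and `C² = −1` we get `C γ_μ = −γ_μᵀ C`, so `w` commutes with `γ₄` (and with `P±`) and
  `w (γ₄γ_k) = (γ₄γ_k)ᵀ w`; `w` is unitary (`γ_μ` Hermitian with `γ_μ² = 1`);
* colour data (§2): `W_j(Ū) = W̄_j = (W_jᴴ)ᵀ`, `W_j(Ū)ᴴ = W_jᵀ`, hence `A(Ū) = Aᵀ` (first conjunct; no
  Hermiticity needed) and `W_j(Ū) − W_j(Ū)ᴴ = −(W_j − W_jᴴ)ᵀ`;
* lift by the `sliceKron` toolkit of `Sketch.SliceNilpotent` plus `(B ⊗ Γ)ᵀ = Bᵀ ⊗ Γᵀ` (§3): with `K = 1 ⊗ w`,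
  `K D(Ū) = −D(U)ᵀ K`, `K N(Ū) = −N(U)ᵀ K`, `K N(Ū)ᴴ = −(N(U)ᴴ)ᵀ K`,
  `K (A(Ū)⁻¹ ⊗ P⁺ + A(Ū) ⊗ P⁻) = (A ⊗ P⁺ + A⁻¹ ⊗ P⁻)ᵀ K`;
* the inverse (§4): for `m_f > −1`, `det A ≠ 0` (`Sketch.FermionSliceContinuous.sliceMassHop_det_ne_zero`), and
  `N² = 0 = (Nᴴ)²` (`Sketch.SliceNilpotent`) give `M_F⁻¹ = (1 + Nᴴ)(A ⊗ P⁺ + A⁻¹ ⊗ P⁻)(1 + N)`; transposing and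
  conjugating factor by factor (`Sketch.SliceGammaConjugation.conj_mul_mul_eq`) yields
  `M_F(U)⁻ᵀ = K M_F(Ū) Kᴴ`.

Pure theorem file (no definitions); helpers in the sub-namespace `StubFermionSliceMatrixChargeConj`.
[cite: Smit2023, §6.5 (6.91)] [cite: LuciniEtAl2016, §2 and App. D]
-/

noncomputable section

open scoped Matrix BigOperators ComplexConjugate
open Literature.MathematicalPhysics.QuantumFieldTheory Literature.MathematicalPhysics.QuantumLattice

namespace Summit.QuantumFields.QCD.Cruxes.StableActionBridge.TwistedTraceTransfer

namespace StubFermionSliceMatrixChargeConj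

open Matrix
open Summit.QuantumFields.QCD.Cruxes.StableActionBridge.Sketch

/-! ### §1 The `4 × 4` spin algebra of `w = C γ₄` -/

/-- In the chiral basis `γ₄ = σʸ ⊗ σˣ` is antisymmetric: `γ₄ᵀ = −γ₄`. [folklore] -/
theorem euclideanGamma_zero_transpose : (euclideanGamma 0)ᵀ = -euclideanGamma 0 := by
  rw [euclideanGamma_zero]
  ext i j
  fin_cases i <;> fin_cases j <;> simp

/-- `C γ_μ = −γ_μᵀ C` (from `γ_μ C = −C γ_μᵀ` and `C² = −1`). [cite: LuciniEtAl2016, §2 (the charge conjugation matrix)] -/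
theorem chargeConj_mul_euclideanGamma (μ : Fin 4) :
    chargeConj * euclideanGamma μ = -((euclideanGamma μ)ᵀ * chargeConj) := by
  have hCC : chargeConj * -chargeConj = 1 := by
    rw [Matrix.mul_neg, chargeConj_mul_chargeConj, neg_neg]
  calc chargeConj * euclideanGamma μ
      = chargeConj * euclideanGamma μ * (chargeConj * -chargeConj) := by rw [hCC, Matrix.mul_one]
    _ = chargeConj * (euclideanGamma μ * chargeConj) * -chargeConj := by simp only [Matrix.mul_assoc]
    _ = -((euclideanGamma μ)ᵀ * chargeConj) := by
        rw [euclideanGamma_mul_chargeConj]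
        simp only [Matrix.mul_neg, Matrix.neg_mul, neg_neg]
        rw [← Matrix.mul_assoc chargeConj chargeConj, chargeConj_mul_chargeConj]
        simp only [Matrix.neg_mul, Matrix.one_mul]

/-- `w = C γ₄` commutes with `γ₄`: `w γ₄ = C = γ₄ w` (`γ₄ C = −C γ₄ᵀ = C γ₄`). [folklore] -/
theorem cg0_mul_gammaZero :
    chargeConj * euclideanGamma 0 * euclideanGamma 0 = euclideanGamma 0 * (chargeConj * euclideanGamma 0) := by
  rw [Matrix.mul_assoc, euclideanGamma_mul_self, Matrix.mul_one, ← Matrix.mul_assoc,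
    euclideanGamma_mul_chargeConj, euclideanGamma_zero_transpose, Matrix.mul_neg, neg_neg,
    Matrix.mul_assoc, euclideanGamma_mul_self, Matrix.mul_one]

/-- The key covariance of `w = C γ₄`: `w (γ₄γ_k) = (γ₄γ_k)ᵀ w` (both sides equal `C γ_k = −γ_kᵀ C`). [folklore] -/
theorem cg0_mul_gamma0k (k : Fin 4) :
    chargeConj * euclideanGamma 0 * (euclideanGamma 0 * euclideanGamma k) =
      (euclideanGamma 0 * euclideanGamma k)ᵀ * (chargeConj * euclideanGamma 0) := by
  rw [Matrix.mul_assoc, ← Matrix.mul_assoc (euclideanGamma 0), euclideanGamma_mul_self, Matrix.one_mul,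
    Matrix.transpose_mul, euclideanGamma_zero_transpose, Matrix.mul_neg, Matrix.neg_mul,
    Matrix.mul_assoc, ← Matrix.mul_assoc (euclideanGamma 0) chargeConj, euclideanGamma_mul_chargeConj,
    euclideanGamma_zero_transpose, Matrix.mul_neg, neg_neg, Matrix.mul_assoc, euclideanGamma_mul_self,
    Matrix.mul_one, chargeConj_mul_euclideanGamma]

/-- `P⁺ᵀ = P⁻` (`γ₄ᵀ = −γ₄`). [folklore] -/
theorem timeProjPlus_transpose : timeProjPlusᵀ = timeProjMinus := by
  rw [timeProjPlus, timeProjMinus, Matrix.transpose_smul, Matrix.transpose_add, Matrix.transpose_one,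
    euclideanGamma_zero_transpose, sub_eq_add_neg]

/-- `P⁻ᵀ = P⁺` (`γ₄ᵀ = −γ₄`). [folklore] -/
theorem timeProjMinus_transpose : timeProjMinusᵀ = timeProjPlus := by
  rw [timeProjPlus, timeProjMinus, Matrix.transpose_smul, Matrix.transpose_sub, Matrix.transpose_one,
    euclideanGamma_zero_transpose, sub_neg_eq_add]

/-- `w P⁺ = P⁺ w`. [folklore] -/
theorem cg0_mul_timeProjPlus :
    chargeConj * euclideanGamma 0 * timeProjPlus = timeProjPlus * (chargeConj * euclideanGamma 0) := by
  unfold timeProjPlus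
  rw [Matrix.mul_smul, Matrix.smul_mul, Matrix.mul_add, Matrix.add_mul, Matrix.mul_one, Matrix.one_mul,
    cg0_mul_gammaZero]

/-- `w P⁻ = P⁻ w`. [folklore] -/
theorem cg0_mul_timeProjMinus :
    chargeConj * euclideanGamma 0 * timeProjMinus = timeProjMinus * (chargeConj * euclideanGamma 0) := by
  unfold timeProjMinus
  rw [Matrix.mul_smul, Matrix.smul_mul, Matrix.mul_sub, Matrix.sub_mul, Matrix.mul_one, Matrix.one_mul,
    cg0_mul_gammaZero]

/-- `w = C γ₄ = γ₁ γ₃ γ₄` is unitary (each `γ_μ` is Hermitian with `γ_μ² = 1`). [folklore] -/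
theorem cg0_mem_unitaryGroup : chargeConj * euclideanGamma 0 ∈ Matrix.unitaryGroup (Fin 4) ℂ := by
  have hγ : ∀ μ : Fin 4, euclideanGamma μ ∈ Matrix.unitaryGroup (Fin 4) ℂ := fun μ => by
    rw [Matrix.mem_unitaryGroup_iff, Matrix.star_eq_conjTranspose, (euclideanGamma_isHermitian μ).eq,
      euclideanGamma_mul_self]
  exact Submonoid.mul_mem _ (Submonoid.mul_mem _ (hγ 1) (hγ 3)) (hγ 0)

/-! ### §2 Charge conjugation of the colour data: `W_j(Ū) = W̄_j`, `A(Ū) = Aᵀ` -/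

variable {Nf S : ℕ}

/-- Transpose of `B ⊗ Γ`: `(B ⊗ Γ)ᵀ = Bᵀ ⊗ Γᵀ`. [folklore] -/
theorem sliceKron_transpose (B : Matrix (SliceColourVar Nf S) (SliceColourVar Nf S) ℂ)
    (Γ : Matrix (Fin 4) (Fin 4) ℂ) : (sliceKron B Γ)ᵀ = sliceKron Bᵀ Γᵀ := by
  ext p q
  simp only [sliceKron, Matrix.transpose_apply, Matrix.of_apply]

/-- The forward colour hop of the conjugated links is the entrywise conjugate: `W_j(Ū) = W̄_j = (W_jᴴ)ᵀ`. [folklore] -/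
theorem colourHop_suConj (U : GaugeConfig 3 S (Matrix.specialUnitaryGroup (Fin 3) ℂ)) (j : Fin 3) :
    colourHop (Nf := Nf) (fun e => suConj 3 (U e)) j = ((colourHop (Nf := Nf) U j)ᴴ)ᵀ := by
  ext p q
  simp only [colourHop, Matrix.of_apply, Matrix.transpose_apply, Matrix.conjTranspose_apply, coe_suConj,
    Matrix.map_apply]
  split_ifs
  · rfl
  · exact (star_zero ℂ).symm

/-- The backward colour hop of the conjugated links: `W_j(Ū)ᴴ = W_jᵀ`. [folklore] -/
theorem colourHop_suConj_conjTranspose (U : GaugeConfig 3 S (Matrix.specialUnitaryGroup (Fin 3) ℂ))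
    (j : Fin 3) : (colourHop (Nf := Nf) (fun e => suConj 3 (U e)) j)ᴴ = (colourHop (Nf := Nf) U j)ᵀ := by
  rw [colourHop_suConj, ← Matrix.conjTranspose_transpose_eq_transpose_conjTranspose,
    Matrix.conjTranspose_conjTranspose]

/-- `W_j(Ū) − W_j(Ū)ᴴ = −(W_j − W_jᴴ)ᵀ`. [folklore] -/
theorem hopDiff_suConj (U : GaugeConfig 3 S (Matrix.specialUnitaryGroup (Fin 3) ℂ)) (j : Fin 3) :
    colourHop (Nf := Nf) (fun e => suConj 3 (U e)) j - (colourHop (Nf := Nf) (fun e => suConj 3 (U e)) j)ᴴ =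
      -(colourHop (Nf := Nf) U j - (colourHop U j)ᴴ)ᵀ := by
  rw [colourHop_suConj_conjTranspose, colourHop_suConj, Matrix.transpose_sub, neg_sub]

/-- **First conjunct: `A(Ū) = A(U)ᵀ`** for Smit's `A = diag(m_f + 4) − ½ Σ_j (W_j + W_jᴴ)`
(`W_j(Ū) + W_j(Ū)ᴴ = (W_jᴴ)ᵀ + W_jᵀ`). [cite: Smit2023, §6.5 (6.74)] -/
theorem sliceMassHop_suConj (U : GaugeConfig 3 S (Matrix.specialUnitaryGroup (Fin 3) ℂ))
    (mq : Fin Nf → ℝ) : sliceMassHop (fun e => suConj 3 (U e)) mq = (sliceMassHop U mq)ᵀ := by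
  unfold sliceMassHop
  rw [Matrix.transpose_sub, Matrix.diagonal_transpose, Matrix.transpose_smul, Matrix.transpose_sum]
  congr 2
  refine Finset.sum_congr rfl fun j _ => ?_
  rw [Matrix.transpose_add, colourHop_suConj_conjTranspose, colourHop_suConj, add_comm]

/-! ### §3 Lift to the slice quark modes: `K = 1 ⊗ w` -/

variable [NeZero S]

/-- `K Kᴴ = 1` on the slice quark modes, `K = 1 ⊗ w`. [folklore] -/
theorem sliceKron_cg0_mul_conjTranspose :
    sliceKron (Nf := Nf) (S := S) 1 (chargeConj * euclideanGamma 0) *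
        sliceKron 1 (chargeConj * euclideanGamma 0)ᴴ = 1 := by
  rw [SliceNilpotent.sliceKron_mul, Matrix.mul_one, ← Matrix.star_eq_conjTranspose,
    Matrix.mem_unitaryGroup_iff.1 cg0_mem_unitaryGroup, SliceNilpotent.sliceKron_one_one]

/-- `K (1 ⊗ P⁺) = (1 ⊗ P⁺) K`. [folklore] -/
theorem sliceKron_cg0_mul_sliceKron_timeProjPlus :
    sliceKron (Nf := Nf) (S := S) 1 (chargeConj * euclideanGamma 0) * sliceKron 1 timeProjPlus =
      sliceKron 1 timeProjPlus * sliceKron 1 (chargeConj * euclideanGamma 0) := by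
  rw [SliceNilpotent.sliceKron_mul, SliceNilpotent.sliceKron_mul, cg0_mul_timeProjPlus]

/-- `K (1 ⊗ P⁻) = (1 ⊗ P⁻) K`. [folklore] -/
theorem sliceKron_cg0_mul_sliceKron_timeProjMinus :
    sliceKron (Nf := Nf) (S := S) 1 (chargeConj * euclideanGamma 0) * sliceKron 1 timeProjMinus =
      sliceKron 1 timeProjMinus * sliceKron 1 (chargeConj * euclideanGamma 0) := by
  rw [SliceNilpotent.sliceKron_mul, SliceNilpotent.sliceKron_mul, cg0_mul_timeProjMinus]

/-- **`K D(Ū) = −D(U)ᵀ K`**: termwise `(W_j(Ū) − W_j(Ū)ᴴ) ⊗ w γ₄γ_j = −(W_j − W_jᴴ)ᵀ ⊗ (γ₄γ_j)ᵀ w`. [cite: Smit2023, §6.5 (6.75)] -/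
theorem cg0_mul_sliceDiracKinetic_suConj (U : GaugeConfig 3 S (Matrix.specialUnitaryGroup (Fin 3) ℂ)) :
    sliceKron (Nf := Nf) (S := S) 1 (chargeConj * euclideanGamma 0) *
        sliceDiracKinetic (fun e => suConj 3 (U e)) =
      -((sliceDiracKinetic (Nf := Nf) U)ᵀ * sliceKron 1 (chargeConj * euclideanGamma 0)) := by
  unfold sliceDiracKinetic
  rw [Matrix.transpose_smul, Matrix.transpose_sum, Matrix.mul_smul, Matrix.smul_mul, Finset.mul_sum,
    Finset.sum_mul, ← smul_neg, ← Finset.sum_neg_distrib]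
  congr 1
  refine Finset.sum_congr rfl fun j _ => ?_
  rw [sliceKron_transpose, SliceNilpotent.sliceKron_mul, SliceNilpotent.sliceKron_mul, Matrix.one_mul,
    Matrix.mul_one, hopDiff_suConj, cg0_mul_gamma0k, SliceNilpotent.sliceKron_neg_left]

/-- `Nᵀ = (1 ⊗ P⁻) Dᵀ (1 ⊗ P⁺)` (`P±ᵀ = P∓`). [folklore] -/
theorem sliceNilp_transpose (U : GaugeConfig 3 S (Matrix.specialUnitaryGroup (Fin 3) ℂ)) :
    (sliceNilp (Nf := Nf) U)ᵀ = sliceKron 1 timeProjMinus * (sliceDiracKinetic U)ᵀ * sliceKron 1 timeProjPlus := by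
  unfold sliceNilp
  rw [Matrix.transpose_mul, Matrix.transpose_mul, sliceKron_transpose, sliceKron_transpose,
    Matrix.transpose_one, timeProjPlus_transpose, timeProjMinus_transpose, Matrix.mul_assoc]

/-- `(Nᴴ)ᵀ = (1 ⊗ P⁺) Dᵀ (1 ⊗ P⁻)` (`Nᴴ = (1 ⊗ P⁺) D (1 ⊗ P⁻)`, `P±ᵀ = P∓`). [folklore] -/
theorem sliceNilp_conjTranspose_transpose (U : GaugeConfig 3 S (Matrix.specialUnitaryGroup (Fin 3) ℂ)) :
    ((sliceNilp (Nf := Nf) U)ᴴ)ᵀ =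
      sliceKron 1 timeProjPlus * (sliceDiracKinetic U)ᵀ * sliceKron 1 timeProjMinus := by
  rw [SliceGammaConjugation.sliceNilp_conjTranspose, Matrix.transpose_mul, Matrix.transpose_mul,
    sliceKron_transpose, sliceKron_transpose, Matrix.transpose_one, timeProjPlus_transpose,
    timeProjMinus_transpose, Matrix.mul_assoc]

/-- **`K N(Ū) = −N(U)ᵀ K`.** [cite: Smit2023, §6.5 (6.84)] -/
theorem cg0_mul_sliceNilp_suConj (U : GaugeConfig 3 S (Matrix.specialUnitaryGroup (Fin 3) ℂ)) :
    sliceKron (Nf := Nf) (S := S) 1 (chargeConj * euclideanGamma 0) * sliceNilp (fun e => suConj 3 (U e)) =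
      -((sliceNilp (Nf := Nf) U)ᵀ * sliceKron 1 (chargeConj * euclideanGamma 0)) := by
  rw [sliceNilp_transpose]
  unfold sliceNilp
  rw [← Matrix.mul_assoc, ← Matrix.mul_assoc, sliceKron_cg0_mul_sliceKron_timeProjMinus,
    Matrix.mul_assoc _ _ (sliceDiracKinetic _), cg0_mul_sliceDiracKinetic_suConj, Matrix.mul_neg,
    Matrix.neg_mul, Matrix.mul_assoc, Matrix.mul_assoc, sliceKron_cg0_mul_sliceKron_timeProjPlus,
    ← Matrix.mul_assoc, ← Matrix.mul_assoc]

/-- **`K N(Ū)ᴴ = −(N(U)ᴴ)ᵀ K`.** [cite: Smit2023, §6.5 (6.84)] -/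
theorem cg0_mul_sliceNilp_suConj_conjTranspose (U : GaugeConfig 3 S (Matrix.specialUnitaryGroup (Fin 3) ℂ)) :
    sliceKron (Nf := Nf) (S := S) 1 (chargeConj * euclideanGamma 0) *
        (sliceNilp (fun e => suConj 3 (U e)))ᴴ =
      -(((sliceNilp (Nf := Nf) U)ᴴ)ᵀ * sliceKron 1 (chargeConj * euclideanGamma 0)) := by
  rw [sliceNilp_conjTranspose_transpose, SliceGammaConjugation.sliceNilp_conjTranspose]
  rw [← Matrix.mul_assoc, ← Matrix.mul_assoc, sliceKron_cg0_mul_sliceKron_timeProjPlus,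
    Matrix.mul_assoc _ _ (sliceDiracKinetic _), cg0_mul_sliceDiracKinetic_suConj, Matrix.mul_neg,
    Matrix.neg_mul, Matrix.mul_assoc, Matrix.mul_assoc, sliceKron_cg0_mul_sliceKron_timeProjMinus,
    ← Matrix.mul_assoc, ← Matrix.mul_assoc]

/-- **`K (A(Ū)⁻¹ ⊗ P⁺ + A(Ū) ⊗ P⁻) = (A ⊗ P⁺ + A⁻¹ ⊗ P⁻)ᵀ K`** (`A(Ū) = Aᵀ`, `(A⁻¹)ᵀ = (Aᵀ)⁻¹`,
`P±ᵀ = P∓`, `w P± = P± w`). [cite: Smit2023, §6.5 (6.91)] -/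
theorem cg0_mul_timeKernel_suConj (U : GaugeConfig 3 S (Matrix.specialUnitaryGroup (Fin 3) ℂ))
    (mq : Fin Nf → ℝ) :
    sliceKron 1 (chargeConj * euclideanGamma 0) *
        (sliceKron (sliceMassHop (fun e => suConj 3 (U e)) mq)⁻¹ timeProjPlus +
          sliceKron (sliceMassHop (fun e => suConj 3 (U e)) mq) timeProjMinus) =
      (sliceKron (sliceMassHop U mq) timeProjPlus + sliceKron (sliceMassHop U mq)⁻¹ timeProjMinus)ᵀ *
        sliceKron 1 (chargeConj * euclideanGamma 0) := by
  rw [sliceMassHop_suConj, Matrix.transpose_add, sliceKron_transpose, sliceKron_transpose,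
    timeProjPlus_transpose, timeProjMinus_transpose, Matrix.transpose_nonsing_inv, Matrix.mul_add,
    Matrix.add_mul, SliceNilpotent.sliceKron_mul, SliceNilpotent.sliceKron_mul,
    SliceNilpotent.sliceKron_mul, SliceNilpotent.sliceKron_mul, Matrix.one_mul, Matrix.one_mul,
    Matrix.mul_one, Matrix.mul_one, cg0_mul_timeProjPlus, cg0_mul_timeProjMinus, add_comm]

/-! ### §4 The inverse `M_F⁻¹ = (1 + Nᴴ)(A ⊗ P⁺ + A⁻¹ ⊗ P⁻)(1 + N)` -/

/-- `(A⁻¹ ⊗ P⁺ + A ⊗ P⁻)(A ⊗ P⁺ + A⁻¹ ⊗ P⁻) = 1` for invertible `A`. [cite: Smit2023, §6.5 (6.91)] -/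
theorem timeKernel_mul_timeKernel_inv {A : Matrix (SliceColourVar Nf S) (SliceColourVar Nf S) ℂ}
    (hA : IsUnit A.det) :
    (sliceKron A⁻¹ timeProjPlus + sliceKron A timeProjMinus) *
        (sliceKron A timeProjPlus + sliceKron A⁻¹ timeProjMinus) = 1 := by
  rw [Matrix.add_mul, Matrix.mul_add, Matrix.mul_add, SliceNilpotent.sliceKron_mul,
    SliceNilpotent.sliceKron_mul, SliceNilpotent.sliceKron_mul, SliceNilpotent.sliceKron_mul,
    Matrix.nonsing_inv_mul A hA, Matrix.mul_nonsing_inv A hA, TimeKernelPosDef.timeProjPlus_mul_self,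
    timeProjPlus_mul_timeProjMinus, TimeKernelPosDef.timeProjMinus_mul_timeProjPlus,
    TimeKernelPosDef.timeProjMinus_mul_self, SliceNilpotent.sliceKron_zero_right,
    SliceNilpotent.sliceKron_zero_right, add_zero, zero_add,
    SliceNilpotent.sliceKron_timeProjPlus_add_timeProjMinus]

omit [NeZero S] in
/-- In a monoid, `a a' = b b' = c c' = 1` give `(a b c)(c' b' a') = 1`. [folklore] -/
theorem triple_mul_triple_eq_one {R : Type*} [Monoid R] {a a' b b' c c' : R} (ha : a * a' = 1)
    (hb : b * b' = 1) (hc : c * c' = 1) : a * b * c * (c' * b' * a') = 1 := by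
  rw [show a * b * c * (c' * b' * a') = a * (b * (c * c') * b') * a' by simp only [mul_assoc], hc,
    mul_one, hb, mul_one, ha]

/-- **`M_F(U)⁻¹ = (1 + Nᴴ)(A ⊗ P⁺ + A⁻¹ ⊗ P⁻)(1 + N)`** for invertible `A = A(U)`
(`(1 − N)(1 + N) = 1 = (1 − Nᴴ)(1 + Nᴴ)` by `N² = 0`, and the time-kernel identity). [cite: Smit2023, §6.5 (6.91)] -/
theorem fermionSliceMatrix_inv (U : GaugeConfig 3 S (Matrix.specialUnitaryGroup (Fin 3) ℂ))
    (mq : Fin Nf → ℝ) (hA : IsUnit (sliceMassHop U mq).det) :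
    (fermionSliceMatrix U mq)⁻¹ =
      (1 + (sliceNilp U)ᴴ) *
        (sliceKron (sliceMassHop U mq) timeProjPlus + sliceKron (sliceMassHop U mq)⁻¹ timeProjMinus) *
          (1 + sliceNilp U) := by
  apply Matrix.inv_eq_right_inv
  unfold fermionSliceMatrix
  exact triple_mul_triple_eq_one (SliceNilpotent.one_sub_sliceNilp_mul_one_add U).1
    (timeKernel_mul_timeKernel_inv hA)
    (SliceNilpotent.one_sub_mul_one_add_of_mul_self _
      (SliceNilpotent.sliceNilp_conjTranspose_mul_self_and_isUnit U).1).1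

/-- **Second conjunct: `(M_F(U)⁻¹)ᵀ = K M_F(Ū) Kᴴ`**, `K = 1 ⊗ C γ₄`, for invertible `A(U)`. [cite: Smit2023, §6.5 (6.91)] [cite: LuciniEtAl2016, App. D] -/
theorem fermionSliceMatrix_inv_transpose (U : GaugeConfig 3 S (Matrix.specialUnitaryGroup (Fin 3) ℂ))
    (mq : Fin Nf → ℝ) (hA : IsUnit (sliceMassHop U mq).det) :
    ((fermionSliceMatrix U mq)⁻¹)ᵀ =
      sliceKron (1 : Matrix (SliceColourVar Nf S) (SliceColourVar Nf S) ℂ) (chargeConj * euclideanGamma 0) *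
        fermionSliceMatrix (fun e => suConj 3 (U e)) mq *
          (sliceKron (1 : Matrix (SliceColourVar Nf S) (SliceColourVar Nf S) ℂ)
            (chargeConj * euclideanGamma 0))ᴴ := by
  rw [fermionSliceMatrix_inv U mq hA, Matrix.transpose_mul, Matrix.transpose_mul, ← Matrix.mul_assoc,
    SliceNilpotent.sliceKron_conjTranspose, Matrix.conjTranspose_one]
  unfold fermionSliceMatrix
  symm
  refine SliceGammaConjugation.conj_mul_mul_eq ?_ (cg0_mul_timeKernel_suConj U mq) ?_
    sliceKron_cg0_mul_conjTranspose
  · rw [Matrix.transpose_add, Matrix.transpose_one, Matrix.mul_sub, Matrix.mul_one, Matrix.add_mul,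
      Matrix.one_mul, cg0_mul_sliceNilp_suConj, sub_neg_eq_add]
  · rw [Matrix.transpose_add, Matrix.transpose_one, Matrix.mul_sub, Matrix.mul_one, Matrix.add_mul,
      Matrix.one_mul, cg0_mul_sliceNilp_suConj_conjTranspose, sub_neg_eq_add]

end StubFermionSliceMatrixChargeConj

/-- **Stub `stub_fermionSliceMatrix_chargeConj` of line `twisted_trace_transfer` (sub-goal Q2b₁ of step E3):
charge conjugation of Smit's one-particle fermionic transfer matrix.**  With the unitary spin matrix
`w = C γ₄` (`C = chargeConj = γ₁γ₃`, `C⁻¹ γ_μ C = −γ_μᵀ`; `γ₄ = euclideanGamma 0`), for all bare masses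
`m_f > −1` and every spatial link configuration `U` with entrywise conjugate `Ū` (`suConj 3`):
`A(Ū) = A(U)ᵀ` for Smit's `A = sliceMassHop`, and `(M_F(U)⁻¹)ᵀ = (1 ⊗ w) M_F(Ū) (1 ⊗ w)ᴴ` for
`M_F = (1 − N)(A⁻¹ ⊗ P⁺ + A ⊗ P⁻)(1 − Nᴴ)` (`fermionSliceMatrix`): `M_F⁻ᵀ = (1 + Nᵀ)(Aᵀ ⊗ P⁻ + A⁻ᵀ ⊗ P⁺)(1 + N̄)`
and conjugation by `w` fixes `P±` while `w γ₄γ_j w⁻¹ = (γ₄γ_j)ᵀ`, so that `(1 ⊗ w) N(Ū) (1 ⊗ w)⁻¹ = −Nᵀ`.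
[cite: Smit2023, §6.5 (6.91)] [cite: LuciniEtAl2016, §2 and App. D] -/
theorem stub_fermionSliceMatrix_chargeConj : ∀ (Nf S : ℕ) [NeZero S] (mq : Fin Nf → ℝ), (∀ f, -1 < mq f) →
    ∃ w : Matrix (Fin 4) (Fin 4) ℂ, w ∈ Matrix.unitaryGroup (Fin 4) ℂ ∧
      ∀ U : GaugeConfig 3 S (Matrix.specialUnitaryGroup (Fin 3) ℂ),
        sliceMassHop (fun e => suConj 3 (U e)) mq = (sliceMassHop U mq)ᵀ ∧
        ((fermionSliceMatrix U mq)⁻¹)ᵀ =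
          sliceKron (1 : Matrix (SliceColourVar Nf S) (SliceColourVar Nf S) ℂ) w *
            fermionSliceMatrix (fun e => suConj 3 (U e)) mq *
              (sliceKron (1 : Matrix (SliceColourVar Nf S) (SliceColourVar Nf S) ℂ) w)ᴴ := by
  intro Nf S _ mq hm
  exact ⟨chargeConj * euclideanGamma 0, StubFermionSliceMatrixChargeConj.cg0_mem_unitaryGroup, fun U =>
    ⟨StubFermionSliceMatrixChargeConj.sliceMassHop_suConj U mq,
      StubFermionSliceMatrixChargeConj.fermionSliceMatrix_inv_transpose U mq
        (isUnit_iff_ne_zero.mpr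
          (Sketch.FermionSliceContinuous.sliceMassHop_det_ne_zero U mq hm))⟩⟩

end Summit.QuantumFields.QCD.Cruxes.StableActionBridge.TwistedTraceTransfer

end
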